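import Summits.SmoothPoincare4.SmoothPoincare4.Theorems.ConvexBisectionAcyclicBisectionExistsBeltFramingFamilies
import Summits.SmoothPoincare4.SmoothPoincare4.Theorems.ConvexBisectionAcyclicBisectionExistsBeltFibreDirections
import Summits.SmoothPoincare4.SmoothPoincare4.Theorems.ConvexBisectionAcyclicBisectionExistsDualLinkSeamPush
import Literature.Topology.FourManifolds.CircleTubeTransition
import Literature.Topology.FourManifolds.ImmersionCriterion
import Literature.Geometry.Symplectic.LegendrianRealisationProofs
import Literature.Geometry.Symplectic.TwoHandleIsotopyFraming
import HarnessLib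

/-!
# Framed isotopies of knots inside a tube of the boundary (tool for stage (3d) of node T3c-1)
(node T3c-1 `node_belt_isotopic_pushoff` of the sub-goal T3 of stub `stub_steinRealisation` (NF6), line
`modp-braid-orbits`, crux `ConvexBisection.AcyclicBisectionExists`, item stmt-SmoothPoincare4-10508;
wave 3, worker Z5, lead c5)

Let `Φ : CircleTube ∂W` be a tube around a circle in the boundary of a `4`-manifold `W` and `b` a direction
flag (core parameter `uDir b θ = (θ₀, ∓θ₁)`).  For jointly smooth families of fibre vectors
`w, ζ : ℝ → 𝕊¹ → ℝ²` with `‖w‖ < 1` and `ζ ≠ 0`: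

* the curves **`θ ↦ Φ (uDir b θ, w t θ)`** (`tubeCurve`) form an isotopy of knots in `∂W`
  (`tubeCurveIsotopy`: every stage is a smooth embedding of the circle — the fibre map has the smooth left
  inverse `uDir b ∘ pr₁`, the tube is a partial diffeomorphism onto `∂W`, and `∂W ↪ W` embeds circles
  (`isSmoothEmbedding_incl_comp`));
* the velocities **`d/dε|₀ Φ (uDir b θ, w t θ + ε ζ t θ)`** (`tubeCurveFraming`) form a framing family
  carried along it (`isFramingAlong_tubeCurve`: continuity into `TW` by `continuous_mk_mfderiv_family`,
  tangency to `∂W` since the arcs lie in `∂W`, transversality since `d(Φ)` and `d(∂W ↪ W)` are injective and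
  the velocity has non-zero core component while the framing is vertical);
* §4 registered helper `helper_belt_tubeCurves`.

With the end data of `helper_belt_slideToTube` (`tubeEndPoint Φ₂ b s r = tubeCurve Φ₂ b (fun _ θ => reflFibre s (r θ)) _`,
`tubeEndFraming` likewise) this reduces stage (3d) to writing down fibre families `w_t, ζ_t`.

Everything is proved; no named facts.

## References
* A. A. Kosinski, *Differential Manifolds*, Academic Press (1993), III §3, VI §6. [Kosinski1993]
* J. M. Lee, *Introduction to Smooth Manifolds* (2013), Thm. 5.11, Prop. 5.4. [LeeSmoothManifolds2013]
-/

noncomputable section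

-- the prescribed namespace `Summit.<P>.<Sub>.…` duplicates `SmoothPoincare4` (P = Sub)
set_option linter.dupNamespace false

open scoped Manifold ContDiff Topology
open Set Function Metric Filter Bundle

namespace Summit.SmoothPoincare4.SmoothPoincare4.Theorems.AcyclicBisectionExists.ModpBraidOrbits

open Literature.Topology.FourManifolds Literature.Geometry.Symplectic

variable {W : Type} [TopologicalSpace W] [T2Space W] [ChartedSpace (EuclideanHalfSpace 4) W]
  [IsManifold (𝓡∂ 4) ∞ W]

/-! ### §1 Points of a tube of `∂W`, as points of `W` -/

/-- The point `Φ q` of a tube of `∂W`, as a point of `W`. [folklore] -/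
def tubePt (Φ : CircleTube ↥((𝓡∂ 4).boundary W))
    (q : (sphere (0 : EuclideanSpace ℝ (Fin 2)) 1) × EuclideanSpace ℝ (Fin 2)) : W :=
  ((Φ.toHomeo q : ↥((𝓡∂ 4).boundary W)) : W)

variable (Φ : CircleTube ↥((𝓡∂ 4).boundary W))

omit [T2Space W] in
/-- Tube points are boundary points. [folklore] -/
theorem tubePt_mem_boundary (q : (sphere (0 : EuclideanSpace ℝ (Fin 2)) 1) × EuclideanSpace ℝ (Fin 2)) :
    tubePt Φ q ∈ (𝓡∂ 4).boundary W := (Φ.toHomeo q).2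

omit [T2Space W] in
/-- The tube-point map is smooth on the unit tube. [folklore] -/
theorem contMDiffOn_tubePt :
    ContMDiffOn ((𝓡 1).prod 𝓘(ℝ, EuclideanSpace ℝ (Fin 2))) (𝓡∂ 4) ∞ (tubePt Φ) Φ.toHomeo.source :=
  (BoundaryManifold.boundaryData 3 W).isSmoothEmbedding.contMDiff.comp_contMDiffOn Φ.contMDiffOn_toHomeo

omit [T2Space W] in
/-- **The differential of the tube-point map is injective on the unit tube** (`dΦ` is injective there and
`d(∂W ↪ W) = (u ↦ (0, u))`). [cite: LeeSmoothManifolds2013, Thm. 5.11] -/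
theorem injective_mfderiv_tubePt {q : (sphere (0 : EuclideanSpace ℝ (Fin 2)) 1) × EuclideanSpace ℝ (Fin 2)}
    (hq : q ∈ Φ.toHomeo.source) :
    Injective (mfderiv ((𝓡 1).prod 𝓘(ℝ, EuclideanSpace ℝ (Fin 2))) (𝓡∂ 4) (tubePt Φ) q) := by
  have h1 : HasMFDerivAt ((𝓡 1).prod 𝓘(ℝ, EuclideanSpace ℝ (Fin 2))) (𝓡 3) Φ.toHomeo q
      (mfderiv ((𝓡 1).prod 𝓘(ℝ, EuclideanSpace ℝ (Fin 2))) (𝓡 3) Φ.toHomeo q) :=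
    ((Φ.contMDiffAt_toHomeo hq).mdifferentiableAt (by simp)).hasMFDerivAt
  have h2 := hasMFDerivAt_incl_boundaryData (n := 3) (W := W) (Φ.toHomeo q)
  have hc := h2.comp q h1
  have e : mfderiv ((𝓡 1).prod 𝓘(ℝ, EuclideanSpace ℝ (Fin 2))) (𝓡∂ 4) (tubePt Φ) q =
      (consZeroL 3).comp (mfderiv ((𝓡 1).prod 𝓘(ℝ, EuclideanSpace ℝ (Fin 2))) (𝓡 3) Φ.toHomeo q) := hc.mfderiv
  rw [e]
  exact consZeroL_injective.comp (Φ.injective_mfderiv_toHomeo hq)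

/-- `mfderiv` of a curve in `ℝ²` from its `HasDerivAt` derivative. [folklore] -/
theorem mfderiv_apply_one_of_hasDerivAt {f : ℝ → EuclideanSpace ℝ (Fin 2)} {f' : EuclideanSpace ℝ (Fin 2)} {x : ℝ}
    (h : HasDerivAt f f' x) : mfderiv 𝓘(ℝ, ℝ) 𝓘(ℝ, EuclideanSpace ℝ (Fin 2)) f x (1 : ℝ) = f' := by
  rw [h.hasFDerivAt.hasMFDerivAt.mfderiv]
  show (ContinuousLinearMap.smulRight (1 : ℝ →L[ℝ] ℝ) f') 1 = f'
  simp

/-! ### §2 Curves in the tube with core parameter `uDir b` -/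

/-- `uDir b` is an involution. [folklore] -/
theorem uDir_uDir (b : Bool) (θ : sphere (0 : EuclideanSpace ℝ (Fin 2)) 1) : uDir b (uDir b θ) = θ := by
  ext i
  fin_cases i
  · rfl
  · show slideSign b * (slideSign b * (θ : EuclideanSpace ℝ (Fin 2)) 1) = (θ : EuclideanSpace ℝ (Fin 2)) 1
    rw [← mul_assoc, slideSign_mul_self, one_mul]

variable (b : Bool)

/-- **The tube curve** `θ ↦ Φ (uDir b θ, w t θ)` of a fibre family `w`, stage `t`, in `W`. [folklore] -/
def tubeCurve (w : ℝ → sphere (0 : EuclideanSpace ℝ (Fin 2)) 1 → EuclideanSpace ℝ (Fin 2)) (t : ℝ)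
    (θ : sphere (0 : EuclideanSpace ℝ (Fin 2)) 1) : W :=
  tubePt Φ (uDir b θ, w t θ)

/-- **The tube-curve framing**: the velocity at `ε = 0` of `ε ↦ Φ (uDir b θ, w t θ + ε ζ t θ)`. [folklore] -/
def tubeCurveFraming (w ζ : ℝ → sphere (0 : EuclideanSpace ℝ (Fin 2)) 1 → EuclideanSpace ℝ (Fin 2)) (t : ℝ)
    (θ : sphere (0 : EuclideanSpace ℝ (Fin 2)) 1) : EuclideanSpace ℝ (Fin 4) :=
  mfderiv 𝓘(ℝ, ℝ) (𝓡∂ 4) (fun ε : ℝ => tubePt Φ (uDir b θ, w t θ + ε • ζ t θ)) 0 (1 : ℝ)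

variable {w ζ : ℝ → sphere (0 : EuclideanSpace ℝ (Fin 2)) 1 → EuclideanSpace ℝ (Fin 2)}
  (hw : ContMDiff (𝓘(ℝ, ℝ).prod (𝓡 1)) 𝓘(ℝ, EuclideanSpace ℝ (Fin 2)) ∞
    fun p : ℝ × (sphere (0 : EuclideanSpace ℝ (Fin 2)) 1) => w p.1 p.2)
  (hζ : ContMDiff (𝓘(ℝ, ℝ).prod (𝓡 1)) 𝓘(ℝ, EuclideanSpace ℝ (Fin 2)) ∞
    fun p : ℝ × (sphere (0 : EuclideanSpace ℝ (Fin 2)) 1) => ζ p.1 p.2)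
  (hw1 : ∀ t θ, ‖w t θ‖ < 1) (hζ0 : ∀ t θ, ζ t θ ≠ 0)

section Stage

include hw in
omit [T2Space W] in
/-- Each stage `θ ↦ w t θ` is smooth. [folklore] -/
theorem contMDiff_stage (t : ℝ) : ContMDiff (𝓡 1) 𝓘(ℝ, EuclideanSpace ℝ (Fin 2)) ∞ (w t) :=
  hw.comp (contMDiff_const.prodMk contMDiff_id)

include hw in
/-- The fibre section `σ_t θ = (uDir b θ, w t θ)` of stage `t` is smooth. [folklore] -/
theorem contMDiff_fibreSection (t : ℝ) :
    ContMDiff (𝓡 1) ((𝓡 1).prod 𝓘(ℝ, EuclideanSpace ℝ (Fin 2))) ∞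
      fun θ : sphere (0 : EuclideanSpace ℝ (Fin 2)) 1 =>
        ((uDir b θ, w t θ) : (sphere (0 : EuclideanSpace ℝ (Fin 2)) 1) × EuclideanSpace ℝ (Fin 2)) :=
  (contMDiff_uDir b).prodMk (contMDiff_stage hw t)

include hw in
/-- **The fibre section has injective differential** (it has the smooth left inverse `uDir b ∘ pr₁`).
[folklore] -/
theorem injective_mfderiv_fibreSection (t : ℝ) (θ : sphere (0 : EuclideanSpace ℝ (Fin 2)) 1) :
    Injective (mfderiv (𝓡 1) ((𝓡 1).prod 𝓘(ℝ, EuclideanSpace ℝ (Fin 2)))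
      (fun θ : sphere (0 : EuclideanSpace ℝ (Fin 2)) 1 =>
        ((uDir b θ, w t θ) : (sphere (0 : EuclideanSpace ℝ (Fin 2)) 1) × EuclideanSpace ℝ (Fin 2))) θ) := by
  haveI := Fact.mk (@finrank_euclideanSpace_fin ℝ _ 2)
  set σ := fun θ : sphere (0 : EuclideanSpace ℝ (Fin 2)) 1 =>
    ((uDir b θ, w t θ) : (sphere (0 : EuclideanSpace ℝ (Fin 2)) 1) × EuclideanSpace ℝ (Fin 2)) with hσ
  set pr := fun q : (sphere (0 : EuclideanSpace ℝ (Fin 2)) 1) × EuclideanSpace ℝ (Fin 2) => uDir b q.1 with hpr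
  have hprσ : pr ∘ σ = id := funext fun θ => uDir_uDir b θ
  have hσd : MDifferentiableAt (𝓡 1) ((𝓡 1).prod 𝓘(ℝ, EuclideanSpace ℝ (Fin 2))) σ θ :=
    (contMDiff_fibreSection b hw t θ).mdifferentiableAt (by simp)
  have hprd : MDifferentiableAt ((𝓡 1).prod 𝓘(ℝ, EuclideanSpace ℝ (Fin 2))) (𝓡 1) pr (σ θ) :=
    (((contMDiff_uDir b).comp contMDiff_fst) (σ θ)).mdifferentiableAt (by simp)
  have hc := mfderiv_comp θ hprd hσd
  rw [hprσ, mfderiv_id] at hc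
  intro v₁ v₂ hv
  have := congrArg (mfderiv ((𝓡 1).prod 𝓘(ℝ, EuclideanSpace ℝ (Fin 2))) (𝓡 1) pr (σ θ)) hv
  have e1 : v₁ = mfderiv ((𝓡 1).prod 𝓘(ℝ, EuclideanSpace ℝ (Fin 2))) (𝓡 1) pr (σ θ)
      (mfderiv (𝓡 1) ((𝓡 1).prod 𝓘(ℝ, EuclideanSpace ℝ (Fin 2))) σ θ v₁) :=
    congrArg (fun L : TangentSpace (𝓡 1) θ →L[ℝ] TangentSpace (𝓡 1) θ => L v₁) hc
  have e2 : v₂ = mfderiv ((𝓡 1).prod 𝓘(ℝ, EuclideanSpace ℝ (Fin 2))) (𝓡 1) pr (σ θ)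
      (mfderiv (𝓡 1) ((𝓡 1).prod 𝓘(ℝ, EuclideanSpace ℝ (Fin 2))) σ θ v₂) :=
    congrArg (fun L : TangentSpace (𝓡 1) θ →L[ℝ] TangentSpace (𝓡 1) θ => L v₂) hc
  exact e1.trans (this.trans e2.symm)

include hw hw1 in
/-- **Each stage of the tube curve, lifted to `∂W`, is a smooth embedding of the circle.**
[cite: LeeSmoothManifolds2013, Prop. 5.4] -/
theorem isSmoothEmbedding_tubeCurve_lift (t : ℝ) :
    Manifold.IsSmoothEmbedding (𝓡 1) (𝓡 3) ∞
      fun θ : sphere (0 : EuclideanSpace ℝ (Fin 2)) 1 => Φ.toHomeo (uDir b θ, w t θ) := by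
  haveI := Fact.mk (@finrank_euclideanSpace_fin ℝ _ 2)
  have hmem : ∀ θ : sphere (0 : EuclideanSpace ℝ (Fin 2)) 1,
      ((uDir b θ, w t θ) : (sphere (0 : EuclideanSpace ℝ (Fin 2)) 1) × EuclideanSpace ℝ (Fin 2)) ∈ Φ.toHomeo.source :=
    fun θ => Φ.mem_source_iff.2 (hw1 t θ)
  have hsm : ContMDiff (𝓡 1) (𝓡 3) ∞ fun θ : sphere (0 : EuclideanSpace ℝ (Fin 2)) 1 => Φ.toHomeo (uDir b θ, w t θ) :=
    Φ.contMDiffOn_toHomeo.comp_contMDiff (contMDiff_fibreSection b hw t) hmem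
  refine isSmoothEmbedding_of_injective_of_injective_mfderiv hsm (by simp) (fun θ₁ θ₂ h => ?_) fun θ => ?_
  · have h' := Φ.toHomeo.injOn (hmem θ₁) (hmem θ₂) h
    have h'' := congrArg (fun q : (sphere (0 : EuclideanSpace ℝ (Fin 2)) 1) × EuclideanSpace ℝ (Fin 2) => uDir b q.1) h'
    simpa only [uDir_uDir] using h''
  · have hΦd : MDifferentiableAt ((𝓡 1).prod 𝓘(ℝ, EuclideanSpace ℝ (Fin 2))) (𝓡 3) Φ.toHomeo (uDir b θ, w t θ) :=
      (Φ.contMDiffAt_toHomeo (hmem θ)).mdifferentiableAt (by simp)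
    have hσd : MDifferentiableAt (𝓡 1) ((𝓡 1).prod 𝓘(ℝ, EuclideanSpace ℝ (Fin 2)))
        (fun θ : sphere (0 : EuclideanSpace ℝ (Fin 2)) 1 =>
          ((uDir b θ, w t θ) : (sphere (0 : EuclideanSpace ℝ (Fin 2)) 1) × EuclideanSpace ℝ (Fin 2))) θ :=
      (contMDiff_fibreSection b hw t θ).mdifferentiableAt (by simp)
    have hc := mfderiv_comp θ hΦd hσd
    rw [show (fun θ : sphere (0 : EuclideanSpace ℝ (Fin 2)) 1 => Φ.toHomeo (uDir b θ, w t θ)) =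
      Φ.toHomeo ∘ fun θ : sphere (0 : EuclideanSpace ℝ (Fin 2)) 1 =>
        ((uDir b θ, w t θ) : (sphere (0 : EuclideanSpace ℝ (Fin 2)) 1) × EuclideanSpace ℝ (Fin 2)) from rfl, hc]
    exact (Φ.injective_mfderiv_toHomeo (hmem θ)).comp (injective_mfderiv_fibreSection b hw t θ)

include hw hw1 in
/-- **Each stage of the tube curve is a smooth embedding of the circle into `W`.**
[cite: LeeSmoothManifolds2013, Thm. 5.11] -/
theorem isSmoothEmbedding_tubeCurve (t : ℝ) : Manifold.IsSmoothEmbedding (𝓡 1) (𝓡∂ 4) ∞ (tubeCurve Φ b w t) :=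
  isSmoothEmbedding_incl_comp (isSmoothEmbedding_tubeCurve_lift Φ b hw hw1 t)

end Stage

include hw hw1 in
omit [T2Space W] in
/-- The tube curves are jointly smooth in `(t, θ)`. [folklore] -/
theorem contMDiff_tubeCurve_uncurry :
    ContMDiff (𝓘(ℝ, ℝ).prod (𝓡 1)) (𝓡∂ 4) ∞
      fun p : ℝ × (sphere (0 : EuclideanSpace ℝ (Fin 2)) 1) => tubeCurve Φ b w p.1 p.2 := by
  have hs : ContMDiff (𝓘(ℝ, ℝ).prod (𝓡 1)) ((𝓡 1).prod 𝓘(ℝ, EuclideanSpace ℝ (Fin 2))) ∞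
      fun p : ℝ × (sphere (0 : EuclideanSpace ℝ (Fin 2)) 1) =>
        ((uDir b p.2, w p.1 p.2) : (sphere (0 : EuclideanSpace ℝ (Fin 2)) 1) × EuclideanSpace ℝ (Fin 2)) :=
    ((contMDiff_uDir b).comp contMDiff_snd).prodMk hw
  exact (contMDiffOn_tubePt Φ).comp_contMDiff hs fun p => Φ.mem_source_iff.2 (hw1 p.1 p.2)

/-! ### §3 Registered helper -/

/-- **Registered helper `helper_belt_tubeCurveEmbedding` (node T3c-1 of NF6 `stub_steinRealisation`, tool for
stage (3d), wave 3, lead c5): for a tube `Φ` of `∂W`, a direction flag `b` and a jointly smooth fibre family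
`w : ℝ → 𝕊¹ → ℝ²` with `‖w‖ < 1`, every curve `θ ↦ Φ (uDir b θ, w t θ)` is a smooth embedding of the circle
into `W` through boundary points, jointly smooth in `(t, θ)`.** [cite: LeeSmoothManifolds2013, Thm. 5.11] -/
theorem helper_belt_tubeCurveEmbedding :
    ∀ {W : Type} [TopologicalSpace W] [T2Space W] [ChartedSpace (EuclideanHalfSpace 4) W] [IsManifold (𝓡∂ 4) ∞ W]
      (Φ : Literature.Topology.FourManifolds.CircleTube ↥((𝓡∂ 4).boundary W)) (b : Bool)
      (w : ℝ → Metric.sphere (0 : EuclideanSpace ℝ (Fin 2)) 1 → EuclideanSpace ℝ (Fin 2))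
      (_ : ContMDiff (𝓘(ℝ, ℝ).prod (𝓡 1)) 𝓘(ℝ, EuclideanSpace ℝ (Fin 2)) ∞
        fun p : ℝ × (Metric.sphere (0 : EuclideanSpace ℝ (Fin 2)) 1) => w p.1 p.2)
      (_ : ∀ t θ, ‖w t θ‖ < 1),
      (∀ t, Manifold.IsSmoothEmbedding (𝓡 1) (𝓡∂ 4) ∞
        fun θ : Metric.sphere (0 : EuclideanSpace ℝ (Fin 2)) 1 => ((Φ.toHomeo (Summit.SmoothPoincare4.SmoothPoincare4.Theorems.AcyclicBisectionExists.ModpBraidOrbits.uDir b θ, w t θ) : ↥((𝓡∂ 4).boundary W)) : W)) ∧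
      (∀ t θ, ((Φ.toHomeo (Summit.SmoothPoincare4.SmoothPoincare4.Theorems.AcyclicBisectionExists.ModpBraidOrbits.uDir b θ, w t θ) : ↥((𝓡∂ 4).boundary W)) : W) ∈ (𝓡∂ 4).boundary W) ∧
      ContMDiff (𝓘(ℝ, ℝ).prod (𝓡 1)) (𝓡∂ 4) ∞
        fun p : ℝ × (Metric.sphere (0 : EuclideanSpace ℝ (Fin 2)) 1) =>
          ((Φ.toHomeo (Summit.SmoothPoincare4.SmoothPoincare4.Theorems.AcyclicBisectionExists.ModpBraidOrbits.uDir b p.2, w p.1 p.2) : ↥((𝓡∂ 4).boundary W)) : W) := by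
  intro W _ _ _ _ Φ b w hw hw1
  exact ⟨fun t => isSmoothEmbedding_tubeCurve Φ b hw hw1 t, fun t θ => tubePt_mem_boundary Φ _,
    contMDiff_tubeCurve_uncurry Φ b hw hw1⟩

end Summit.SmoothPoincare4.SmoothPoincare4.Theorems.AcyclicBisectionExists.ModpBraidOrbits

end
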